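import Summits.CriticalPhenomena.PercolationContinuityZ3.Theorems.FK.InfiniteVolumeDLRBoxExact
import Mathlib.MeasureTheory.Function.ConditionalExpectation.Basic
import HarnessLib

/-!
# FK-continuity transplant, FO-06 (construction half): the DLR equation (4.30) for every box limit
# `φ^b_{p,q}` and every finite region — Grimmett 2006, Thm. (4.34)(b) `φ^b_{p,q} ∈ R_{p,q}`

Cell `fk-continuity` (bschramm), row FO-06b-6; support file for the FK-continuity transplant
(`--supports stmt-CriticalPhenomena-4575`); builds on p205010 (kernel theorem, internal audit signed;
external expert review pending). No named facts, no sorries, standard axioms. General dimension `d`, both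
boundary conditions `b`, `0 ≤ p ≤ 1`, `q ≥ 1`. Banked infinite-volume structure (GRC Thm. (4.34)(b)) for the
Literature vocabulary (`IsFKGibbs`, whose docstring records that "(4.30) itself is not a field") and fk-ref
FO-17; not an END-STATE dependency of the cell (not consumed by `_r3`); it says nothing about FH / TP_FK or
continuity at `p_c`.

**Main results.** For every box limit `P` (`IsBoxLimit d b p q P`), every finite region `Λ ⊂ ℤ^d` with edge
set `E_Λ = edgesIn (zdGraph d) Λ`, every inside pattern `η ⊆ E_Λ`:

* `IsBoxLimit.real_cylEvent_inter_eq_setIntegral_of_determinedBy` — for `H` determined by finitely many pairs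
  off `E_Λ`: `P({ω ∩ E_Λ = η} ∩ H) = ∫_H φ^ω_{Λ,p,q}(η) P(dω)`;
* `IsBoxLimit.real_cylEvent_inter_eq_setIntegral` — the same for every `H ∈ 𝒯_Λ = outsideEvents d Λ`
  (06a-g2's ring approximation `exists_determinedBy_measure_symmDiff_lt`);
* `IsBoxLimit.condExp_indicator_cylEvent` — **(4.30)**: `P[1_{ω ∩ E_Λ = η} | 𝒯_Λ] = φ^·_{Λ,p,q}(η)` a.s.;
* `IsBoxLimit.isDLRRandomCluster`, `isDLRRandomCluster_rcLimit` — **Thm. (4.34)(b): `φ^b_{p,q} ∈ R_{p,q}`**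
  (Def. (4.29), the class `IsDLRRandomCluster` of `InfiniteVolumeDLRDefs.lean`).

The one-edge case `Λ = {x, y}` (`E_Λ = {e}`, kernel `p` on `K_e`, `p/(p + q(1-p))` off `K_e`) is 06b-g2's
`IsBoxLimit.real_edgeOpen_inter_eq` (`InfiniteVolumeOneEdgeDLRClosed.lean`); it is not re-derived here.

**Proof** (Grimmett's proof of Thm. (4.31), pp. 83–86, for regions, with cylinder convergence in place of the
portmanteau theorem).  Fix `m` with `Λ ⊆ Λ_m` and the local bad event `D_m = regionBadEvent Λ m`.  Off `D_m`
the kernel is read inside `Λ_m` (`InfiniteVolumeDLRLocality.lean`), and the exact finite-volume DLR identity of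
the box laws (`InfiniteVolumeDLRBoxKernel.lean`) is a FINITE sum of products "kernel value × probability of a
local event", which passes to the limit `n → ∞` term by term:
`P({ω ∩ E_Λ = η} ∩ H ∖ D_m) = ∫_{H ∖ D_m} φ^ω_{Λ,p,q}(η) P(dω)`.  The two missing pieces are at most `P(D_m)`
each, and `P(D_m) → 0` (`p < 1`: deletion tolerance and a.s. uniqueness of the infinite cluster); at `p = 1`
everything is open a.s. and the identity is checked directly.

## References

* G. Grimmett, *The Random-Cluster Model*, Springer 2006: Def. (4.29) eq. (4.30), Thm. (4.31), Thm. (4.34)(b),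
  Lemma (4.39), proof of Thm. (4.31) eqs. (4.45)–(4.53), pp. 81–86. [Grimmett2006]
-/

noncomputable section

open MeasureTheory Set Filter
open scoped Topology ENNReal

namespace Summit.CriticalPhenomena.PercolationContinuityZ3.Theorems.FK

open Literature.Probability.Percolation Literature.Probability.LatticeModels

variable {d : ℕ}

/-! ### The local kernel as a finite combination of cylinder indicators -/

section LocalKernel

variable {p q : ℝ}

open Classical in
/-- The kernel read inside `Λ_m`, `ω ↦ φ^{ω ∩ Λ_m²}_{Λ,p,q}(η)`, is a finite combination of indicators of cylinder
events over the pairs of `Λ_m` off `E_Λ`. [cite: Grimmett2006, §4.2 (4.12)] -/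
theorem rcCondProb_inter_sym2_eq_sum_indicator (Λ : Finset (Site d)) (m : ℕ) (η : Finset (Sym2 (Site d)))
    (ω : BondConfig (Site d)) :
    rcCondProb p q Λ (ω ∩ ↑((box d m).sym2)) η =
      ∑ ζ ∈ ((box d m).sym2 \ edgesIn (zdGraph d) Λ).powerset,
        (cylEvent ((box d m).sym2 \ edgesIn (zdGraph d) Λ) ζ).indicator (fun _ => rcCondProb p q Λ ↑ζ η) ω := by
  rw [← rcCondProb_coe_filter_mem_eq Λ m ω η,
    ← sum_powerset_ite_mem_cylEvent _ ω fun ζ => rcCondProb p q Λ ↑ζ η]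
  refine Finset.sum_congr rfl fun ζ _ => ?_
  rw [Set.indicator_apply]

/-- The kernel read inside `Λ_m` is measurable. [folklore] -/
theorem measurable_rcCondProb_inter_sym2 (p q : ℝ) (Λ : Finset (Site d)) (m : ℕ) (η : Finset (Sym2 (Site d))) :
    Measurable fun ω : BondConfig (Site d) => rcCondProb p q Λ (ω ∩ ↑((box d m).sym2)) η :=
  (measurable_rcCondProb p q Λ η).comp (measurable_inter_const _)

/-- **Integral of the local kernel** against a finite measure: `∫_S φ^{ω ∩ Λ_m²}_{Λ,p,q}(η) μ(dω)
= ∑_ζ φ^ζ_{Λ,p,q}(η) · μ(S ∩ {ω = ζ on Λ_m² ∖ E_Λ})`. [cite: Grimmett2006, proof of Thm. (4.31) eq. (4.45)] -/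
theorem setIntegral_rcCondProb_inter_sym2_eq_sum (μ : Measure (BondConfig (Site d))) [IsFiniteMeasure μ]
    (Λ : Finset (Site d)) (m : ℕ) (η : Finset (Sym2 (Site d))) (S : Set (BondConfig (Site d))) :
    ∫ ω in S, rcCondProb p q Λ (ω ∩ ↑((box d m).sym2)) η ∂μ =
      ∑ ζ ∈ ((box d m).sym2 \ edgesIn (zdGraph d) Λ).powerset,
        rcCondProb p q Λ ↑ζ η * μ.real (S ∩ cylEvent ((box d m).sym2 \ edgesIn (zdGraph d) Λ) ζ) := by
  set E' := (box d m).sym2 \ edgesIn (zdGraph d) Λ with hE'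
  have hpt : (fun ω : BondConfig (Site d) => rcCondProb p q Λ (ω ∩ ↑((box d m).sym2)) η) =
      fun ω => ∑ ζ ∈ E'.powerset, (cylEvent E' ζ).indicator (fun _ => rcCondProb p q Λ ↑ζ η) ω :=
    funext fun ω => rcCondProb_inter_sym2_eq_sum_indicator Λ m η ω
  rw [hpt, integral_finsetSum]
  · refine Finset.sum_congr rfl fun ζ _ => ?_
    rw [setIntegral_indicator (measurableSet_cylEvent E' ζ), setIntegral_const, smul_eq_mul, mul_comm]
  · intro ζ _
    exact ((integrable_const _).indicator (measurableSet_cylEvent E' ζ)).integrableOn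

/-- The kernel is integrable (bounded by `1`, measurable) for a finite measure (`0 ≤ p ≤ 1`, `q > 0`).
[folklore] -/
theorem integrable_rcCondProb (μ : Measure (BondConfig (Site d))) [IsFiniteMeasure μ] (hp : p ∈ Set.Icc (0 : ℝ) 1)
    (hq : 0 < q) (Λ : Finset (Site d)) {η : Finset (Sym2 (Site d))} (hη : η ⊆ edgesIn (zdGraph d) Λ) :
    Integrable (fun ω : BondConfig (Site d) => rcCondProb p q Λ ω η) μ := by
  refine Integrable.mono' (integrable_const (1 : ℝ)) (measurable_rcCondProb p q Λ η).aestronglyMeasurable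
    (ae_of_all _ fun ω => ?_)
  rw [Real.norm_eq_abs, abs_le]
  exact ⟨by linarith [rcCondProb_nonneg hp hq Λ ω η], rcCondProb_le_one hp hq Λ ω hη⟩

/-- Set integrals of the kernel lie in `[0, μ(S)]`. [folklore] -/
theorem setIntegral_rcCondProb_mem_Icc (μ : Measure (BondConfig (Site d))) [IsFiniteMeasure μ]
    (hp : p ∈ Set.Icc (0 : ℝ) 1) (hq : 0 < q) (Λ : Finset (Site d)) {η : Finset (Sym2 (Site d))}
    (hη : η ⊆ edgesIn (zdGraph d) Λ) (S : Set (BondConfig (Site d))) :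
    ∫ ω in S, rcCondProb p q Λ ω η ∂μ ∈ Set.Icc 0 (μ.real S) := by
  constructor
  · exact setIntegral_nonneg_of_ae (ae_of_all _ fun ω => rcCondProb_nonneg hp hq Λ ω η)
  · have h := norm_setIntegral_le_of_norm_le_const (μ := μ) (s := S) (measure_lt_top μ S)
      (f := fun ω => rcCondProb p q Λ ω η) (C := 1) fun ω _ => by
        rw [Real.norm_eq_abs, abs_le]
        exact ⟨by linarith [rcCondProb_nonneg hp hq Λ ω η], rcCondProb_le_one hp hq Λ ω hη⟩
    rw [one_mul, Real.norm_eq_abs] at h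
    exact (le_abs_self _).trans h

end LocalKernel

/-! ### The DLR equation against local outside events -/

section Local

variable {b : Bool} {p q : ℝ} {P : Measure (BondConfig (Site d))}

/-- A local event determined by pairs off `E_Λ`, cut by a cylinder and the bad event, is local. [folklore] -/
theorem isLocalEvent_inter_inter_of_determinedBy {Λ : Finset (Site d)} {m : ℕ} {H : Set (BondConfig (Site d))}
    {T : Finset (Sym2 (Site d))} (hH : DeterminedBy H ↑T) (E' ζ : Finset (Sym2 (Site d))) :
    IsLocalEvent (H ∩ (regionBadEvent Λ m)ᶜ ∩ cylEvent E' ζ) := by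
  classical
  exact (IsLocalEvent.inter ⟨T, hH⟩ (isLocalEvent_regionBadEvent Λ m).compl).inter (isLocalEvent_cylEvent E' ζ)

/-- **The DLR identity off the bad event** (limit `n → ∞` of `InfiniteVolumeDLRBoxKernel`'s exact box identity,
term by term over the finitely many local patterns): for a box limit `P`, `Λ ⊆ Λ_m`, `η ⊆ E_Λ`, `H` determined by
finitely many pairs off `E_Λ`,
`P({ω ∩ E_Λ = η} ∩ H ∖ D_m) = ∑_ζ φ^ζ_{Λ,p,q}(η) · P(H ∖ D_m ∩ {ω = ζ on Λ_m² ∖ E_Λ})`.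
[cite: Grimmett2006, proof of Thm. (4.31) eqs. (4.45)–(4.46)] -/
theorem IsBoxLimit.real_cylEvent_inter_inter_compl_regionBadEvent_eq_sum (hP : IsBoxLimit d b p q P)
    (hp : p ∈ Set.Icc (0 : ℝ) 1) (hq : 0 < q) {Λ : Finset (Site d)} {m : ℕ} (hΛm : Λ ⊆ box d m)
    {η : Finset (Sym2 (Site d))} (hη : η ⊆ edgesIn (zdGraph d) Λ) {H : Set (BondConfig (Site d))}
    {T : Finset (Sym2 (Site d))} (hH : DeterminedBy H ↑T) (hTU : Disjoint (↑T : Set (Sym2 (Site d))) ↑(edgesIn (zdGraph d) Λ)) :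
    P.real (cylEvent (edgesIn (zdGraph d) Λ) η ∩ H ∩ (regionBadEvent Λ m)ᶜ) =
      ∑ ζ ∈ ((box d m).sym2 \ edgesIn (zdGraph d) Λ).powerset, rcCondProb p q Λ ↑ζ η *
        P.real (H ∩ (regionBadEvent Λ m)ᶜ ∩ cylEvent ((box d m).sym2 \ edgesIn (zdGraph d) Λ) ζ) := by
  classical
  have hHl : IsLocalEvent H := ⟨T, hH⟩
  have hL : IsLocalEvent (cylEvent (edgesIn (zdGraph d) Λ) η ∩ H ∩ (regionBadEvent Λ m)ᶜ) :=
    ((isLocalEvent_cylEvent _ η).inter hHl).inter (isLocalEvent_regionBadEvent Λ m).compl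
  have h1 := hP.tendsto_real hL
  have h2 : Tendsto (fun n => ∑ ζ ∈ ((box d m).sym2 \ edgesIn (zdGraph d) Λ).powerset, rcCondProb p q Λ ↑ζ η *
      (rcBoxLaw d b p q n).real (H ∩ (regionBadEvent Λ m)ᶜ ∩ cylEvent ((box d m).sym2 \ edgesIn (zdGraph d) Λ) ζ))
      atTop (𝓝 (∑ ζ ∈ ((box d m).sym2 \ edgesIn (zdGraph d) Λ).powerset, rcCondProb p q Λ ↑ζ η *
        P.real (H ∩ (regionBadEvent Λ m)ᶜ ∩ cylEvent ((box d m).sym2 \ edgesIn (zdGraph d) Λ) ζ))) :=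
    tendsto_finsetSum _ fun ζ _ => (hP.tendsto_real (isLocalEvent_inter_inter_of_determinedBy hH _ ζ)).const_mul _
  refine tendsto_nhds_unique h1 (h2.congr' ?_)
  filter_upwards [eventually_ge_atTop (m + 1)] with n hn
  exact (rcBoxLaw_real_cylEvent_inter_inter_compl_regionBadEvent_eq_sum b hp hq hn hΛm hη hH hTU
    (measurableSet_of_isLocalEvent_holds hHl)).symm

/-- **The DLR identity off the bad event, integral form**: `P({ω ∩ E_Λ = η} ∩ H ∖ D_m) = ∫_{H ∖ D_m} φ^ω_{Λ,p,q}(η) P(dω)`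
(the kernel is read inside `Λ_m` off `D_m`, and there it is a finite combination of cylinder indicators).
[cite: Grimmett2006, proof of Thm. (4.31) eqs. (4.45)–(4.46)] -/
theorem IsBoxLimit.real_cylEvent_inter_inter_compl_eq_setIntegral (hP : IsBoxLimit d b p q P)
    (hp : p ∈ Set.Icc (0 : ℝ) 1) (hq : 0 < q) {Λ : Finset (Site d)} {m : ℕ} (hΛm : Λ ⊆ box d m)
    {η : Finset (Sym2 (Site d))} (hη : η ⊆ edgesIn (zdGraph d) Λ) {H : Set (BondConfig (Site d))}
    {T : Finset (Sym2 (Site d))} (hH : DeterminedBy H ↑T) (hTU : Disjoint (↑T : Set (Sym2 (Site d))) ↑(edgesIn (zdGraph d) Λ)) :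
    P.real (cylEvent (edgesIn (zdGraph d) Λ) η ∩ H ∩ (regionBadEvent Λ m)ᶜ) =
      ∫ ω in H ∩ (regionBadEvent Λ m)ᶜ, rcCondProb p q Λ ω η ∂P := by
  classical
  haveI := hP.isProbabilityMeasure
  have hHm : MeasurableSet H := measurableSet_of_isLocalEvent_holds ⟨T, hH⟩
  have hSm : MeasurableSet (H ∩ (regionBadEvent Λ m)ᶜ) := hHm.inter (measurableSet_regionBadEvent Λ m).compl
  rw [hP.real_cylEvent_inter_inter_compl_regionBadEvent_eq_sum hp hq hΛm hη hH hTU,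
    ← setIntegral_rcCondProb_inter_sym2_eq_sum P Λ m η (H ∩ (regionBadEvent Λ m)ᶜ)]
  -- off the bad event (and on lattice configurations, a.s.) the kernel is read inside `Λ_m`
  refine setIntegral_congr_ae hSm ?_
  filter_upwards [hP.ae_subset_edgeSet hp hq] with ω hωE hωS
  exact (rcCondProb_eq_inter_sym2_of_not_mem_regionBadEvent hΛm hωE hωS.2 hη).symm

/-- **The DLR equation against local outside events, `p < 1`**: for a box limit `P` (`0 ≤ p < 1`, `q ≥ 1`),
`η ⊆ E_Λ` and `H` determined by finitely many pairs off `E_Λ`,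
`P({ω ∩ E_Λ = η} ∩ H) = ∫_H φ^ω_{Λ,p,q}(η) P(dω)` — the two sides differ by at most `2 P(D_m) → 0`.
[cite: Grimmett2006, Thm. (4.34)(b); proof of Thm. (4.31) pp. 84–86] -/
theorem IsBoxLimit.real_cylEvent_inter_eq_setIntegral_of_lt_one (hP : IsBoxLimit d b p q P)
    (hp : p ∈ Set.Ico (0 : ℝ) 1) (hq : 1 ≤ q) {Λ : Finset (Site d)} {η : Finset (Sym2 (Site d))}
    (hη : η ⊆ edgesIn (zdGraph d) Λ) {H : Set (BondConfig (Site d))} {T : Finset (Sym2 (Site d))}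
    (hH : DeterminedBy H ↑T) (hTU : Disjoint (↑T : Set (Sym2 (Site d))) ↑(edgesIn (zdGraph d) Λ)) :
    P.real (cylEvent (edgesIn (zdGraph d) Λ) η ∩ H) = ∫ ω in H, rcCondProb p q Λ ω η ∂P := by
  classical
  haveI := hP.isProbabilityMeasure
  have hp' : p ∈ Set.Icc (0 : ℝ) 1 := ⟨hp.1, hp.2.le⟩
  have hq0 : 0 < q := one_pos.trans_le hq
  have hHm : MeasurableSet H := measurableSet_of_isLocalEvent_holds ⟨T, hH⟩
  have hCm : MeasurableSet (cylEvent (edgesIn (zdGraph d) Λ) η) := measurableSet_cylEvent _ η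
  obtain ⟨m₀, hm₀⟩ := DCT16.exists_subset_box Λ
  set Bad : ℕ → Set (BondConfig (Site d)) := fun m => regionBadEvent Λ m with hBad
  have hBm : ∀ m, MeasurableSet (Bad m) := fun m => measurableSet_regionBadEvent Λ m
  have hint : Integrable (fun ω => rcCondProb p q Λ ω η) P := integrable_rcCondProb P hp' hq0 Λ hη
  -- the difference of the two sides is at most `P(D_m)` in absolute value, for every `m ≥ m₀`
  have hbound : ∀ m, m₀ ≤ m →
      |P.real (cylEvent (edgesIn (zdGraph d) Λ) η ∩ H) - ∫ ω in H, rcCondProb p q Λ ω η ∂P| ≤ P.real (Bad m) := by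
    intro m hm
    have hΛm : Λ ⊆ box d m := hm₀.trans (box_mono d hm)
    have hsplit1 : P.real (cylEvent (edgesIn (zdGraph d) Λ) η ∩ H) =
        P.real (cylEvent (edgesIn (zdGraph d) Λ) η ∩ H ∩ (Bad m)ᶜ) +
          P.real (cylEvent (edgesIn (zdGraph d) Λ) η ∩ H ∩ Bad m) := by
      rw [← measureReal_inter_add_sdiff₀ (s := cylEvent (edgesIn (zdGraph d) Λ) η ∩ H)
        (hBm m).compl.nullMeasurableSet, Set.sdiff_eq, compl_compl]
    have hsplit2 : ∫ ω in H, rcCondProb p q Λ ω η ∂P =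
        ∫ ω in H ∩ (Bad m)ᶜ, rcCondProb p q Λ ω η ∂P + ∫ ω in H ∩ Bad m, rcCondProb p q Λ ω η ∂P := by
      rw [← integral_inter_add_sdiff (hBm m).compl hint.integrableOn, Set.sdiff_eq, compl_compl]
    rw [hsplit1, hsplit2, hP.real_cylEvent_inter_inter_compl_eq_setIntegral hp' hq0 hΛm hη hH hTU,
      add_sub_add_left_eq_sub, abs_le]
    have h1 : P.real (cylEvent (edgesIn (zdGraph d) Λ) η ∩ H ∩ Bad m) ≤ P.real (Bad m) :=
      measureReal_mono Set.inter_subset_right (measure_ne_top P _)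
    have h2 := setIntegral_rcCondProb_mem_Icc P hp' hq0 Λ hη (H ∩ Bad m)
    have h3 : P.real (H ∩ Bad m) ≤ P.real (Bad m) := measureReal_mono Set.inter_subset_right (measure_ne_top P _)
    have h4 : 0 ≤ P.real (cylEvent (edgesIn (zdGraph d) Λ) η ∩ H ∩ Bad m) := measureReal_nonneg
    constructor <;> linarith [h2.1, h2.2]
  -- let `m → ∞`
  have hlim := hP.tendsto_real_regionBadEvent hp hq Λ
  have habs : |P.real (cylEvent (edgesIn (zdGraph d) Λ) η ∩ H) - ∫ ω in H, rcCondProb p q Λ ω η ∂P| ≤ 0 :=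
    ge_of_tendsto hlim (Filter.eventually_atTop.2 ⟨m₀, hbound⟩)
  have := abs_nonneg (P.real (cylEvent (edgesIn (zdGraph d) Λ) η ∩ H) - ∫ ω in H, rcCondProb p q Λ ω η ∂P)
  rw [← sub_eq_zero, ← abs_eq_zero]
  exact le_antisymm habs this

end Local

/-! ### The degenerate parameter `p = 1`: everything is open -/

section One

variable {b : Bool} {q : ℝ} {P : Measure (BondConfig (Site d))}

/-- At `p = 1` the kernel charges only the full pattern `E_Λ`. [cite: Grimmett2006, §4.2 (4.12) (p = 1)] -/
theorem rcCondProb_one_left (hq : 0 < q) (Λ : Finset (Site d)) (ξ : BondConfig (Site d))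
    {η : Finset (Sym2 (Site d))} (hη : η ⊆ edgesIn (zdGraph d) Λ) :
    rcCondProb 1 q Λ ξ η = if η = edgesIn (zdGraph d) Λ then 1 else 0 := by
  classical
  have hw : ∀ η' ⊆ edgesIn (zdGraph d) Λ, rcCondWeight 1 q Λ ξ η' =
      if η' = edgesIn (zdGraph d) Λ then
        q ^ meetClusterCount ((↑η' : Set (Sym2 (Site d))) ∪ (ξ \ ↑(edgesIn (zdGraph d) Λ))) ↑Λ else 0 := by
    intro η' hη'
    rw [rcCondWeight_eq, one_pow, one_mul, sub_self]
    by_cases h : η' = edgesIn (zdGraph d) Λ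
    · rw [if_pos h, h, Finset.sdiff_self, Finset.card_empty, pow_zero, one_mul]
    · rw [if_neg h, zero_pow, zero_mul]
      rw [Ne, Finset.card_eq_zero, Finset.sdiff_eq_empty_iff_subset]
      exact fun h' => h (Finset.Subset.antisymm hη' h')
  have hZ : rcCondPartition 1 q Λ ξ =
      q ^ meetClusterCount ((↑(edgesIn (zdGraph d) Λ) : Set (Sym2 (Site d))) ∪ (ξ \ ↑(edgesIn (zdGraph d) Λ))) ↑Λ := by
    rw [rcCondPartition_eq, Finset.sum_congr rfl fun η' hη' => hw η' (Finset.mem_powerset.1 hη'),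
      Finset.sum_ite_eq' _ (edgesIn (zdGraph d) Λ), if_pos (Finset.mem_powerset_self _)]
  rw [rcCondProb_eq, hw η hη, hZ]
  split_ifs with h
  · subst h; exact div_self (pow_ne_zero _ hq.ne')
  · exact zero_div _

/-- At `p = 1` the random-cluster measure of a finite graph sees every edge open: `{e' closed}` is null
(`e'` an edge of the graph, `q > 0`). [cite: Grimmett2006, §1.2 eq. (1.2) (p = 1)] -/
theorem rcMeasure_one_real_setOf_not_mem_eq_zero {V : Type*} [Fintype V] [DecidableEq V] (G : SimpleGraph V)
    [DecidableRel G.Adj] (hq : 0 < q) (B : Set V) {e' : Sym2 V} (he' : e' ∈ G.edgeFinset) :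
    (rcMeasure G 1 q B).real {ω : BondConfig V | e' ∉ ω} = 0 := by
  classical
  have hp : (1 : ℝ) ∈ Set.Icc (0 : ℝ) 1 := ⟨zero_le_one, le_rfl⟩
  rw [rcMeasure_real_apply G hp hq B]
  refine Finset.sum_eq_zero fun ω hω => ?_
  split_ifs with hmem
  · have hne : (G.edgeFinset \ ω).Nonempty := ⟨e', Finset.mem_sdiff.2 ⟨he', fun h => hmem (Finset.mem_coe.2 h)⟩⟩
    rw [rcWeight, sub_self, zero_pow (Finset.card_ne_zero.2 hne), mul_zero, zero_mul, zero_div]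
  · rfl

/-- At `p = 1` every lattice edge is open almost surely under a box limit. [cite: Grimmett2006, §1.2 eq. (1.2) (p = 1)] -/
theorem IsBoxLimit.measure_setOf_not_mem_eq_zero_of_one_left (hP : IsBoxLimit d b 1 q P) (hq : 0 < q)
    {e : Sym2 (Site d)} (he : e ∈ (zdGraph d).edgeSet) : P {ω | e ∉ ω} = 0 := by
  classical
  haveI := hP.isProbabilityMeasure
  have hloc : IsLocalEvent {ω : BondConfig (Site d) | e ∉ ω} := ⟨{e}, (determinedBy_mem e).compl.mono (by simp)⟩
  have h1 := hP.tendsto_real hloc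
  -- the box laws give this event probability `0` as soon as the box contains `e`
  induction e using Sym2.ind with
  | h x y =>
    have hadj : (zdGraph d).Adj x y := by rwa [SimpleGraph.mem_edgeSet] at he
    obtain ⟨n₀, hn₀⟩ := DCT16.exists_subset_box ({x, y} : Finset (Site d))
    have hx : ∀ n, n₀ ≤ n → x ∈ box d n := fun n hn => box_mono d hn (hn₀ (by simp))
    have hy : ∀ n, n₀ ≤ n → y ∈ box d n := fun n hn => box_mono d hn (hn₀ (by simp))
    have h2 : Tendsto (fun n => (rcBoxLaw d b 1 q n).real {ω : BondConfig (Site d) | s(x, y) ∉ ω}) atTop (𝓝 0) := by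
      refine tendsto_const_nhds.congr' ?_
      filter_upwards [eventually_ge_atTop n₀] with n hn
      haveI := isProbabilityMeasure_rcBoxMeasure b (⟨zero_le_one, le_rfl⟩ : (1 : ℝ) ∈ Set.Icc (0 : ℝ) 1) hq n (d := d)
      have he' : s((⟨x, hx n hn⟩ : ↥(box d n)), ⟨y, hy n hn⟩) ∈ (finsetGraph (zdGraph d) (box d n)).edgeFinset := by
        rw [SimpleGraph.mem_edgeFinset, SimpleGraph.mem_edgeSet, finsetGraph_adj_iff]
        exact hadj
      rw [rcBoxLaw_real_apply b 1 q n (measurableSet_of_isLocalEvent_holds hloc)]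
      have hc : liftEdges (box d n) ⁻¹' {ω : BondConfig (Site d) | s(x, y) ∉ ω} =
          {ω : BondConfig ↥(box d n) | s((⟨x, hx n hn⟩ : ↥(box d n)), ⟨y, hy n hn⟩) ∉ ω} := by
        ext ω
        simp only [Set.mem_preimage, Set.mem_setOf_eq, mk_mem_liftEdges_iff (hx n hn) (hy n hn)]
      rw [hc, rcBoxMeasure]
      exact (rcMeasure_one_real_setOf_not_mem_eq_zero _ hq _ he').symm
    have h0 := tendsto_nhds_unique h1 h2
    rw [measureReal_def, ENNReal.toReal_eq_zero_iff] at h0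
    exact h0.resolve_right (measure_ne_top P _)

/-- At `p = 1`, almost surely every edge of `E_Λ` is open. [cite: Grimmett2006, §1.2 (p = 1)] -/
theorem IsBoxLimit.ae_edgesIn_subset_of_one_left (hP : IsBoxLimit d b 1 q P) (hq : 0 < q) (Λ : Finset (Site d)) :
    ∀ᵐ ω ∂P, (↑(edgesIn (zdGraph d) Λ) : Set (Sym2 (Site d))) ⊆ ω := by
  have : ∀ᵐ ω ∂P, ∀ e ∈ edgesIn (zdGraph d) Λ, e ∈ ω := by
    refine (Finset.eventually_all _).2 fun e he => ?_
    have h0 := hP.measure_setOf_not_mem_eq_zero_of_one_left hq (mem_edgesIn_iff.1 he).1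
    rw [measure_eq_zero_iff_ae_notMem] at h0
    filter_upwards [h0] with ω hω
    simpa using hω
  filter_upwards [this] with ω hω e he using hω e he

/-- **The DLR equation against local outside events, `p = 1`**: both sides are `[η = E_Λ] · P(H)`.
[cite: Grimmett2006, Thm. (4.34)(b) (p = 1 trivial, proof of Thm. (4.31))] -/
theorem IsBoxLimit.real_cylEvent_inter_eq_setIntegral_of_one_left (hP : IsBoxLimit d b 1 q P) (hq : 0 < q)
    {Λ : Finset (Site d)} {η : Finset (Sym2 (Site d))} (hη : η ⊆ edgesIn (zdGraph d) Λ)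
    (H : Set (BondConfig (Site d))) :
    P.real (cylEvent (edgesIn (zdGraph d) Λ) η ∩ H) = ∫ ω in H, rcCondProb 1 q Λ ω η ∂P := by
  classical
  haveI := hP.isProbabilityMeasure
  simp only [rcCondProb_one_left hq Λ _ hη]
  rw [setIntegral_const, smul_eq_mul]
  have hae := hP.ae_edgesIn_subset_of_one_left hq Λ
  by_cases h : η = edgesIn (zdGraph d) Λ
  · rw [if_pos h, mul_one]
    subst h
    refine measureReal_congr (hae.mono fun ω hω => ?_)
    change (ω ∈ cylEvent (edgesIn (zdGraph d) Λ) (edgesIn (zdGraph d) Λ) ∩ H) = (ω ∈ H)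
    refine propext ⟨fun h' => h'.2, fun h' => ⟨?_, h'⟩⟩
    exact mem_cylEvent_iff.2 fun i hi => ⟨fun _ => hi, fun _ => hω (Finset.mem_coe.2 hi)⟩
  · rw [if_neg h, mul_zero]
    obtain ⟨e, heU, heη⟩ : ∃ e ∈ edgesIn (zdGraph d) Λ, e ∉ η :=
      Finset.not_subset.1 fun h' => h (Finset.Subset.antisymm hη h')
    have h0 : P (cylEvent (edgesIn (zdGraph d) Λ) η) = 0 := by
      rw [measure_eq_zero_iff_ae_notMem]
      filter_upwards [hae] with ω hω hωC
      exact heη ((mem_cylEvent_iff.1 hωC e heU).1 (hω (Finset.mem_coe.2 heU)))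
    rw [measureReal_def, measure_mono_null Set.inter_subset_left h0, ENNReal.toReal_zero]

end One

/-! ### The DLR equation against local outside events, all `0 ≤ p ≤ 1` -/

section LocalAll

variable {b : Bool} {p q : ℝ} {P : Measure (BondConfig (Site d))}

/-- **The DLR equation against local outside events**: for every box limit `P` (`0 ≤ p ≤ 1`, `q ≥ 1`, either
boundary condition), every finite region `Λ`, inside pattern `η ⊆ E_Λ` and event `H` determined by finitely
many pairs off `E_Λ`: `P({ω ∩ E_Λ = η} ∩ H) = ∫_H φ^ω_{Λ,p,q}(η) P(dω)`.
[cite: Grimmett2006, Thm. (4.34)(b); proof of Thm. (4.31) pp. 84–86] -/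
theorem IsBoxLimit.real_cylEvent_inter_eq_setIntegral_of_determinedBy (hP : IsBoxLimit d b p q P)
    (hp : p ∈ Set.Icc (0 : ℝ) 1) (hq : 1 ≤ q) {Λ : Finset (Site d)} {η : Finset (Sym2 (Site d))}
    (hη : η ⊆ edgesIn (zdGraph d) Λ) {H : Set (BondConfig (Site d))} {T : Finset (Sym2 (Site d))}
    (hH : DeterminedBy H ↑T) (hTU : Disjoint (↑T : Set (Sym2 (Site d))) ↑(edgesIn (zdGraph d) Λ)) :
    P.real (cylEvent (edgesIn (zdGraph d) Λ) η ∩ H) = ∫ ω in H, rcCondProb p q Λ ω η ∂P := by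
  rcases eq_or_lt_of_le hp.2 with h1 | h1
  · subst h1
    exact hP.real_cylEvent_inter_eq_setIntegral_of_one_left (one_pos.trans_le hq) hη H
  · exact hP.real_cylEvent_inter_eq_setIntegral_of_lt_one ⟨hp.1, h1⟩ hq hη hH hTU

end LocalAll

end Summit.CriticalPhenomena.PercolationContinuityZ3.Theorems.FK

end
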